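import Summits.QuantumFields.BalabanUV.Beta.FP.GradedPackedHess

/-!
# `BalabanUV.Beta.FP.PackedLegBlocks` — road «FP» for binder row D1, ROUTE T, the (T-ID) assembly's «ONE `rw`» (TID § F.8 STEP 2, § F.10 (L2′); leaf-05 g30
# W-leaf05-g30-5 l.45205; an2 g42 W-an2-g42-1 l.45489): **THE PACKED LEG OF A SLICED SYSTEM IN THE FOUR NAMED BLOCKS** —
# `((kkt H [Q;τ])⁻¹).submatrix e e = [[Γ, I_{·κ}],[L_{κ·}, −S₁₁]]`, and the door's torus kernel read directly against those blocks

WHAT.  #22 `GradedPackedHess.mixedVar_signTwist_fromRows_zero` reads a graded bordered system's two-point kernel as `2·hessT (M⁻¹.submatrix e e) …`,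
`e = Sum.map id Sum.inl`.  For the door's systems `M = kkt H [Q; τ]` (form `H`, coarse averaging rows `Q`, slice rows `τ`), an2's Literature
`CompositionSingular.kktInv_eq_fromBlocks` names the inverse `[[Γ, I],[L, −S]]` (`flucCov ∕ minOp ∕ minOpL ∕ effForm`) on `ν ⊕ (κ ⊕ ρ)`; the packed leg keeps
the `κ`-columns of `I`, the `κ`-rows of `L` and the `κκ` corner `−S₁₁`.  §1 `packedLeg_kktInv` — exactly that, as ONE rewrite (road BF-x TA4's
`submatrix_map_inl_fromBlocks` after splitting `I = fromCols …`, `L = fromRows …`, `S = fromBlocks …`); §2 **`mixedVar_signTwist_sliced`** — #22 §3 at `M := kkt H [Q;τ]`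
with the leg ALREADY in the four blocks: the door's torus kernel
`= 2·hessT [[Γ, I∘inl],[L∘inl, −S₁₁]] [[K_a,−Q_aᵀ],[Q_a,0]] [[K_b,−Q_bᵀ],[Q_b,0]] (kkt K_ab Q_ab)` — the shape leaf-05's `RelInvPeriodisedComb* ∕ …OneShot` letters
(`torus_flucCov_eq_* ∕ torus_minOp(L)_submatrix_inl_* ∕ effForm_toBlocks₁₁_*`) substitute into term by term; §3 `trace_bubble_sliced` — the bubble in the four
blocks with the graded signs (#22 §4 `trace_bubble_fromBlocks_signTwist` at this leg: note `S ↦ −S₁₁`).  [folklore]; no `def`, no `def … : Prop`, nothing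
cited, 0 sorry; 0 estimates.

HONEST DEPENDENCY (page 1, mandatory): continuum YM on T⁴ ⇐ BetaPertH ∧ nine spine estimates (0/9 proved); BetaPertH ⇐ (D1) ∧ (D4) ∧ CAP+tail;
G-an2-4 gates asym, D1 and NE2/3/4.  HONEST FRAMING (cell contract, verbatim): «discharging `BetaPertH` makes Bałaban's UV stability UNCONDITIONAL —
a real constructive-QFT result; it is NOT the continuum limit and NOT the Clay problem.»  ABSOLUTE RULE (cell charter, verbatim): «No internally-minted
statement may enter as a cited fact. Every hypothesis is either kernel-proved in this package or a verbatim quotation of a PUBLISHED theorem with page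
reference. The manuscript(s) under audit are NOT citable for their own disputed steps — they are the thing under adjudication; programme-internal
(2001/route/tribunal) claims are never citable.»  Nothing of Bałaban's asserted; 0∕4 row-D1 binders; NOT (T-ID), NOT SDF, NOT D1, NOT BetaPertH, NOT continuum,
NOT Clay.  Road «FP» OWNER, b2b-balaban-beta-d1-p3 gen 21, 2026-08-22.  No existing file touched.
-/

noncomputable section

open scoped BigOperators Matrix

namespace Summit.QuantumFields.BalabanUV.Beta.FP.PackedLegBlocks

open Matrix
open Literature.MathematicalPhysics.QuantumFieldTheory.Balaban1983to89.Beta.Composition (kkt)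
open Literature.MathematicalPhysics.QuantumFieldTheory.Balaban1983to89.Beta.CompositionSingular (effForm flucCov minOp minOpL kktInv_eq_fromBlocks)
open Summit.QuantumFields.BalabanUV.Beta.FP.SecondVarPolarisation (mixedVar)
open Summit.QuantumFields.BalabanUV.Beta.D1BFx.MixedVarPackedHess (hessT submatrix_map_inl_fromBlocks)
open Summit.QuantumFields.BalabanUV.Beta.FP.GradedPackedHess (mixedVar_signTwist_fromRows_zero trace_bubble_fromBlocks_signTwist)

variable {ν κ ρ : Type*} [Fintype ν] [Fintype κ] [Fintype ρ] [DecidableEq ν] [DecidableEq κ] [DecidableEq ρ]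

/-! ## §1 The packed leg in the four named blocks -/

/-- [folklore] **THE PACKED LEG OF A SLICED SYSTEM**: `((kkt H [Q;τ])⁻¹).submatrix e e = [[Γ, I_{·κ}],[L_{κ·}, −S₁₁]]` with `Γ = flucCov`, `I = minOp`,
`L = minOpL`, `S = effForm` of `(H, [Q;τ])` (`CompositionSingular.kktInv_eq_fromBlocks` — note the MINUS on the multiplier corner — packed by road BF-x's
`submatrix_map_inl_fromBlocks`). -/
theorem packedLeg_kktInv (H : Matrix ν ν ℝ) (Q : Matrix κ ν ℝ) (τ : Matrix ρ ν ℝ) :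
    ((kkt H (fromRows Q τ))⁻¹).submatrix (Sum.map id Sum.inl) (Sum.map id Sum.inl)
      = fromBlocks (flucCov H (fromRows Q τ)) ((minOp H (fromRows Q τ)).submatrix id Sum.inl)
          ((minOpL H (fromRows Q τ)).submatrix Sum.inl id) (-((effForm H (fromRows Q τ)).toBlocks₁₁)) := by
  rw [kktInv_eq_fromBlocks]
  ext i j
  rcases i with i | i <;> rcases j with j | j <;> rfl

/-! ## §2 The door's torus kernel against the four blocks -/

/-- [folklore] **THE TWO-POINT KERNEL OF A SLICED SYSTEM IN ITS FOUR BLOCKS**: for `M = kkt H [Q;τ]`, graded first jets `[[K_a, −[Q_a;0]ᵀ],[[Q_a;0],0]]`,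
`[[K_b,…]]` and second jet `kkt K_ab [Q_ab;0]`,
`mixedVar M J_a J_b J_ab = 2·hessT [[Γ, I∘inl],[L∘inl, −S₁₁]] [[K_a,−Q_aᵀ],[Q_a,0]] [[K_b,−Q_bᵀ],[Q_b,0]] (kkt K_ab Q_ab)` — #22 §3 + §1; the four blocks are
exactly what leaf-05's `RelInvPeriodised*` letters name at the (III′) record (fine ∕ coarse: `…Comb*`; one-shot: `…OneShot`). -/
theorem mixedVar_signTwist_sliced (H : Matrix ν ν ℝ) (Q : Matrix κ ν ℝ) (τ : Matrix ρ ν ℝ) (Ka Kb Kab : Matrix ν ν ℝ) (Qa Qb Qab : Matrix κ ν ℝ) :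
    mixedVar (kkt H (fromRows Q τ))
        (fromBlocks Ka (-(fromRows Qa (0 : Matrix ρ ν ℝ))ᵀ) (fromRows Qa (0 : Matrix ρ ν ℝ)) 0)
        (fromBlocks Kb (-(fromRows Qb (0 : Matrix ρ ν ℝ))ᵀ) (fromRows Qb (0 : Matrix ρ ν ℝ)) 0)
        (kkt Kab (fromRows Qab (0 : Matrix ρ ν ℝ)))
      = 2 * hessT (fromBlocks (flucCov H (fromRows Q τ)) ((minOp H (fromRows Q τ)).submatrix id Sum.inl)
            ((minOpL H (fromRows Q τ)).submatrix Sum.inl id) (-((effForm H (fromRows Q τ)).toBlocks₁₁)))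
          (fromBlocks Ka (-Qaᵀ) Qa 0) (fromBlocks Kb (-Qbᵀ) Qb 0) (kkt Kab Qab) := by
  rw [mixedVar_signTwist_fromRows_zero, packedLeg_kktInv]

/-! ## §3 The bubble in the four blocks, graded signs carried -/

/-- [folklore] **THE GRADED BUBBLE OF A SLICED SYSTEM IN ITS FOUR BLOCKS** (#22 §4 at the leg `[[Γ, I′],[L′, −S₁₁]]`, `I′ = I∘inl`, `L′ = L∘inl`):
`tr((leg·V_a)·(leg·V_b)) = tr((ΓK_a + I′Q_a)(ΓK_b + I′Q_b)) − tr(ΓQ_aᵀ(L′K_b − S₁₁Q_b)) − tr((L′K_a − S₁₁Q_a)ΓQ_bᵀ) + tr(L′Q_aᵀL′Q_bᵀ)`. -/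
theorem trace_bubble_sliced (H : Matrix ν ν ℝ) (Q : Matrix κ ν ℝ) (τ : Matrix ρ ν ℝ) (Ka Kb : Matrix ν ν ℝ) (Qa Qb : Matrix κ ν ℝ) :
    (fromBlocks (flucCov H (fromRows Q τ)) ((minOp H (fromRows Q τ)).submatrix id Sum.inl)
          ((minOpL H (fromRows Q τ)).submatrix Sum.inl id) (-((effForm H (fromRows Q τ)).toBlocks₁₁))
        * fromBlocks Ka (-Qaᵀ) Qa 0
        * (fromBlocks (flucCov H (fromRows Q τ)) ((minOp H (fromRows Q τ)).submatrix id Sum.inl)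
            ((minOpL H (fromRows Q τ)).submatrix Sum.inl id) (-((effForm H (fromRows Q τ)).toBlocks₁₁))
          * fromBlocks Kb (-Qbᵀ) Qb 0)).trace
      = (((flucCov H (fromRows Q τ)) * Ka + (minOp H (fromRows Q τ)).submatrix id Sum.inl * Qa)
            * ((flucCov H (fromRows Q τ)) * Kb + (minOp H (fromRows Q τ)).submatrix id Sum.inl * Qb)).trace
        - ((flucCov H (fromRows Q τ)) * Qaᵀ
            * ((minOpL H (fromRows Q τ)).submatrix Sum.inl id * Kb - (effForm H (fromRows Q τ)).toBlocks₁₁ * Qb)).trace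
        - (((minOpL H (fromRows Q τ)).submatrix Sum.inl id * Ka - (effForm H (fromRows Q τ)).toBlocks₁₁ * Qa)
            * ((flucCov H (fromRows Q τ)) * Qbᵀ)).trace
        + ((minOpL H (fromRows Q τ)).submatrix Sum.inl id * Qaᵀ * ((minOpL H (fromRows Q τ)).submatrix Sum.inl id * Qbᵀ)).trace := by
  rw [trace_bubble_fromBlocks_signTwist]
  simp only [Matrix.neg_mul, ← sub_eq_add_neg]

end Summit.QuantumFields.BalabanUV.Beta.FP.PackedLegBlocks

end
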